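import Summits.BirchSwinnertonDyer.BirchSwinnertonDyer.Theorems.PrintCf2RamifiedOffTYZTheoremAOrbitCount
import HarnessLib

/-!
# Route `PrintCf2`, crux stmt-BirchSwinnertonDyer-20509 `RamifiedOffTYZOfFacts`, THEOREM A's target (T2), second half: the orbit of `a₀` under
# `G = Stab(√l) ∩ Stab(ζ₄) ≤ Gal(R/K)` has `g(K)` elements when `Gal(H/K)` acts freely on the `H`-point `(a, b)` and `Stab_G(a₀) ⊆ Stab_G(b₀)`;
# plus the fibre-count-one bookkeeping on the realisation side and its transport
# (cell `bsd-print-cf2`, LEAD cruxlead-20509 g33, line `offtyz-v7`, lineage cycle 34; Theses-free, `def`-free; unconditional)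

HONEST FRAMING (`--supports stmt-BirchSwinnertonDyer-20509`; theorems only, no `sorry`, no new named fact).  BSD is not proved by any of this;
no class is closed by this file; item 23431 (C⁺) and crux 20509 stay OPEN.

* §1 `smul_snd_eq_of_count_eq_one` — fibre count `1` ⟹ `Stab_N(x₀)` fixes `y₀`; `mem_adjoin_of_stabilizer_fixes` — hence `y₀ ∈ ℚ(M^N, x₀)` (Galois
  correspondence in `M/ℚ`); `mem_adjoin_of_image_subset` — transport of such memberships along `j : M → ℂ ← R : e`; `apply_eq_of_mem_adjoin` — an
  automorphism fixing `S` pointwise fixes `ℚ(S)`.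
* §2 `card_image_smul_eq_card_quotient` — `#G•x = #(G/Stab x)` for any action; ★★ `card_orbit_eq_genusClassNumber` — **(T2)**: for `K = ℚ(√−lq)` on R2,
  `R = rayClassField K 𝔪 ⊇ H ∋ rl` (`rl² = l`), `ζ ∈ R` a primitive 4th root of unity, `w ∈ 𝓞 K` with `w² = −lq`, a subgroup `G ≤ Gal(R/K)` with
  `G = Stab(rl) ∩ Stab(ζ)`, and `a, b ∈ H` on which `Gal(H/K)` acts freely with `Stab_G(a) ⊆ Stab_G(b)`: `#G•a = genusClassNumber K`.

References: [folklore] Galois theory; [cite: NeukirchANT1999, Ch. VI §7 (7.1)]; [cite: TianYuanZhang2017, §3.1 (z_n ∈ A(H_n))]; tree p813336, p813802,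
`TheoremAOrbitCount`, `TheoremAHeegnerFree`.
-/

noncomputable section

open scoped Classical nonZeroDivisors
open NumberField IsDedekindDomain MulAction Finset

namespace Summit.BirchSwinnertonDyer.PrintCf2.TheoremAHeegnerOrbit

open Literature.NumberTheory.EllipticCurves Literature.NumberTheory.NumberFields Literature.NumberTheory.GaloisRepresentations
open Literature.NumberTheory.LFunctions.AbelianDensity (artinSymbol)
open Literature.NumberTheory.EllipticCurves.Tian2014 (IsQuadraticFieldOfSqrt)
open Literature.NumberTheory.EllipticCurves.TianYuanZhang2017 (genusClassNumber)
open Summit.BirchSwinnertonDyer.PrintCf2.TheoremAHilbertBridge Summit.BirchSwinnertonDyer.PrintCf2.TheoremAOrderTwoGroup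
open Summit.BirchSwinnertonDyer.PrintCf2.TheoremAAmbiguous Summit.BirchSwinnertonDyer.PrintCf2.TheoremACMAssembly
open Summit.BirchSwinnertonDyer.PrintCf2.TheoremAOrderTwoGlobal Summit.BirchSwinnertonDyer.PrintCf2.TheoremAOrbitCount

/-! ## §1 Fibre count one, Galois correspondence, transport -/

section Realisation

variable {M : Type} [Field M] [NumberField M]

/-- **Fibre count `1` ⟹ `Stab_N(x₀)` fixes `y₀`**: if exactly one element of the orbit `N•(x₀, y₀)` has first coordinate `x₀`, every `ν ∈ N` fixing `x₀`
fixes `y₀` (both `(x₀, y₀)` and `(x₀, ν y₀)` lie in that fibre). [folklore] -/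
theorem smul_snd_eq_of_count_eq_one (N : Subgroup (M ≃ₐ[ℚ] M)) (x₀ y₀ : M)
    (hcount : (((univ : Finset N).image (fun g => g • ((x₀, y₀) : M × M))).filter fun q => q.1 = x₀).card = 1)
    (ν : N) (hν : ν • x₀ = x₀) : ν • y₀ = y₀ := by
  obtain ⟨p, hp⟩ := Finset.card_eq_one.mp hcount
  have h1 : ((x₀, y₀) : M × M) ∈ ((univ : Finset N).image (fun g => g • ((x₀, y₀) : M × M))).filter fun q => q.1 = x₀ :=
    Finset.mem_filter.mpr ⟨Finset.mem_image.mpr ⟨1, Finset.mem_univ _, one_smul _ _⟩, rfl⟩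
  have h2 : ((x₀, ν • y₀) : M × M) ∈ ((univ : Finset N).image (fun g => g • ((x₀, y₀) : M × M))).filter fun q => q.1 = x₀ :=
    Finset.mem_filter.mpr ⟨Finset.mem_image.mpr ⟨ν, Finset.mem_univ _, by rw [Prod.smul_mk, hν]⟩, rfl⟩
  rw [hp, Finset.mem_singleton] at h1 h2
  have := h2.trans h1.symm
  exact (Prod.mk.inj this).2

/-- **`y₀ ∈ ℚ(M^N, x₀)`** when `Stab_N(x₀)` fixes `y₀` (`M/ℚ` Galois: the fixing subgroup of `ℚ(M^N, x₀)` is `Stab_N(x₀)`). [folklore] -/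
theorem mem_adjoin_of_stabilizer_fixes [IsGalois ℚ M] (N : Subgroup (M ≃ₐ[ℚ] M)) (x₀ y₀ : M)
    (h : ∀ ν : N, ν • x₀ = x₀ → ν • y₀ = y₀) :
    y₀ ∈ IntermediateField.adjoin ℚ ((IntermediateField.fixedField N : Set M) ∪ {x₀}) := by
  set E := IntermediateField.adjoin ℚ ((IntermediateField.fixedField N : Set M) ∪ {x₀}) with hE
  rw [← IsGalois.fixedField_fixingSubgroup E, IntermediateField.mem_fixedField_iff]
  intro g hg
  rw [IntermediateField.mem_fixingSubgroup_iff] at hg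
  have hgN : g ∈ N := by
    rw [← IntermediateField.fixingSubgroup_fixedField N, IntermediateField.mem_fixingSubgroup_iff]
    exact fun x hx => hg x (IntermediateField.subset_adjoin ℚ _ (Set.mem_union_left _ hx))
  have hgx : g x₀ = x₀ := hg x₀ (IntermediateField.subset_adjoin ℚ _ (Set.mem_union_right _ (Set.mem_singleton x₀)))
  exact h ⟨g, hgN⟩ hgx

end Realisation

/-- **Transport of `y ∈ ℚ(S)` along embeddings into `ℂ`**: if `j(S) ⊆ e(T)`, `y ∈ ℚ(S)` and `e b = j y`, then `b ∈ ℚ(T)`. [folklore] -/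
theorem mem_adjoin_of_image_subset {M R : Type*} [Field M] [Algebra ℚ M] [Field R] [Algebra ℚ R] (j : M →+* ℂ) (e : R →+* ℂ)
    {S : Set M} {T : Set R} (hST : j '' S ⊆ e '' T) {y : M} (hy : y ∈ IntermediateField.adjoin ℚ S) {b : R} (hb : e b = j y) :
    b ∈ IntermediateField.adjoin ℚ T := by
  have h1 : j y ∈ (IntermediateField.adjoin ℚ S).map j.toRatAlgHom := ⟨y, hy, rfl⟩
  rw [IntermediateField.adjoin_map] at h1
  have h2 : IntermediateField.adjoin ℚ (j.toRatAlgHom '' S) ≤ (IntermediateField.adjoin ℚ T).map e.toRatAlgHom := by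
    rw [IntermediateField.adjoin_map]
    exact IntermediateField.adjoin.mono ℚ _ _ hST
  obtain ⟨r, hr, hre⟩ := h2 h1
  have : r = b := e.injective (hre.trans hb.symm)
  exact this ▸ hr

/-- An automorphism fixing `S` pointwise fixes `ℚ(S)` pointwise. [folklore] -/
theorem apply_eq_of_mem_adjoin {K R : Type*} [Field K] [Field R] [CharZero R] [Algebra ℚ R] [Algebra K R] (g : R ≃ₐ[K] R) {T : Set R}
    (hT : ∀ t ∈ T, g t = t) {b : R} (hb : b ∈ IntermediateField.adjoin ℚ T) : g b = b := by
  -- the subfield of `g`-fixed points contains `ℚ` and `T`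
  let F : IntermediateField ℚ R :=
    { carrier := {r | g r = r}
      mul_mem' := fun {x y} hx hy => by simp only [Set.mem_setOf_eq] at hx hy ⊢; rw [map_mul, hx, hy]
      one_mem' := by simp
      add_mem' := fun {x y} hx hy => by simp only [Set.mem_setOf_eq] at hx hy ⊢; rw [map_add, hx, hy]
      zero_mem' := by simp
      algebraMap_mem' := fun q => by
        simp only [Set.mem_setOf_eq, eq_ratCast]
        exact map_ratCast g q
      inv_mem' := fun x hx => by simp only [Set.mem_setOf_eq] at hx ⊢; rw [map_inv₀, hx] }
  have hle : IntermediateField.adjoin ℚ T ≤ F := IntermediateField.adjoin_le_iff.mpr fun t ht => hT t ht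
  exact hle hb

/-! ## §2 Counting the orbit -/

/-- `#G•x = #(G/Stab x)` for any action of a finite group. [folklore] -/
theorem card_image_smul_eq_card_quotient {G Y : Type*} [Group G] [Fintype G] [MulAction G Y] [DecidableEq Y] (x : Y) :
    ((univ : Finset G).image (fun g => g • x)).card = Nat.card (G ⧸ stabilizer G x) := by
  rw [Nat.card_eq_fintype_card]
  have h : (univ : Finset G).image (fun g => g • x) = (univ : Finset (G ⧸ stabilizer G x)).image (ofQuotientStabilizer G x) := by
    ext y
    simp only [mem_image, mem_univ, true_and]
    constructor
    · rintro ⟨g, rfl⟩; exact ⟨QuotientGroup.mk g, ofQuotientStabilizer_mk G x g⟩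
    · rintro ⟨c, rfl⟩
      obtain ⟨g, rfl⟩ := QuotientGroup.mk_surjective c
      exact ⟨g, (ofQuotientStabilizer_mk G x g).symm⟩
  rw [h, card_image_of_injective _ (injective_ofQuotientStabilizer G x), card_univ]

variable {K : Type} [Field K] [NumberField K]

/-- `#{ρ g : g ∈ G}` for the restriction of a homomorphism to a subgroup is the order of the image subgroup. [folklore] -/
theorem card_image_coe_eq_natCard_map {Γ A : Type*} [Group Γ] [Group A] [Fintype Γ] [DecidableEq A] (res : Γ →* A) (G : Subgroup Γ) :
    ((univ : Finset G).image (fun g : G => res (g : Γ))).card = Nat.card (G.map res) := by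
  have hset : (((univ : Finset G).image (fun g : G => res (g : Γ)) : Finset A) : Set A) = (G.map res : Set A) := by
    ext a
    simp only [Finset.coe_image, Finset.coe_univ, Set.image_univ, Set.mem_range, Subgroup.coe_map, Set.mem_image, SetLike.mem_coe]
    constructor
    · rintro ⟨g, rfl⟩; exact ⟨g, g.2, rfl⟩
    · rintro ⟨g, hg, rfl⟩; exact ⟨⟨g, hg⟩, rfl⟩
  change _ = Nat.card ((G.map res : Subgroup A) : Set A)
  rw [Nat.card_coe_set_eq, ← hset, Set.ncard_coe_finset]

/-- ★★ **(T2): `#G•a = g(K)`.**  `K` imaginary quadratic with `d_K = −lq` on R2 (`l ≡ 1`, `q ≡ 3 (mod 4)`, `q > 4`, `(l/q) = 1`), `w ∈ 𝓞 K` with `w² = −lq`,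
`R = rayClassField K 𝔪 ⊇ H`, `rl ∈ H` with `rl² = l`, `ζ ∈ R` a primitive fourth root of unity, `G ≤ Gal(R/K)` with `G = Stab(rl) ∩ Stab(ζ)`, and `a, b ∈ H` such
that `Gal(H/K)` acts FREELY on `(a, b)` and every `g ∈ G` fixing `a` fixes `b`: the orbit of `a` under `G` has exactly `genusClassNumber K = #Cl(K)²`
elements (unconditionally: `#Cl(K)² = genusClassNumber K` by genus theory).  Proof: `Stab_G(a) = Stab_G(a,b)`, `G` acts on `(a,b)` through `res : Gal(R/K) ↠ Cl(K)` freely, `res(G) = res(Stab rl)`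
(`ζ₄ ∉ H`: `((w), R/K)` negates `ζ`) `= Cl²`. [cite: NeukirchANT1999, Ch. VI §7 (7.1)] [cite: TianYuanZhang2017, §3.1] -/
theorem card_orbit_eq_genusClassNumber (hK : IsImaginaryQuadratic K) {l q : ℕ}
    (hl : l.Prime) (hq : q.Prime) (hl4 : l % 4 = 1) (hq4 : q % 4 = 3)
    (hd : NumberField.discr K = -((l * q : ℕ) : ℤ))
    (w : 𝓞 K) (hw : w ^ 2 = -((l * q : ℕ) : 𝓞 K)) {𝔪 : Ideal (𝓞 K)} (h𝔪 : 𝔪 ≠ ⊥)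
    (rl : hilbertClassField K) (hrl : (IntermediateField.inclusion (hilbertClassField_le_rayClassField h𝔪) rl) ^ 2 = (l : rayClassField K 𝔪))
    (ζ : rayClassField K 𝔪) (hζ : IsPrimitiveRoot ζ 4)
    (G : Subgroup (rayClassField K 𝔪 ≃ₐ[K] rayClassField K 𝔪))
    (hG1 : ∀ g ∈ G, g (IntermediateField.inclusion (hilbertClassField_le_rayClassField h𝔪) rl) = IntermediateField.inclusion (hilbertClassField_le_rayClassField h𝔪) rl)
    (hG3 : ∀ g : rayClassField K 𝔪 ≃ₐ[K] rayClassField K 𝔪,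
      g (IntermediateField.inclusion (hilbertClassField_le_rayClassField h𝔪) rl) = IntermediateField.inclusion (hilbertClassField_le_rayClassField h𝔪) rl →
      g ζ = ζ → g ∈ G)
    (a b : hilbertClassField K) (hfree : ∀ σ : hilbertClassField K ≃ₐ[K] hilbertClassField K, σ a = a → σ b = b → σ = 1)
    (hfib : ∀ g ∈ G, g (IntermediateField.inclusion (hilbertClassField_le_rayClassField h𝔪) a) = IntermediateField.inclusion (hilbertClassField_le_rayClassField h𝔪) a →
      g (IntermediateField.inclusion (hilbertClassField_le_rayClassField h𝔪) b) = IntermediateField.inclusion (hilbertClassField_le_rayClassField h𝔪) b) :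
    ((univ : Finset G).image (fun g => g • IntermediateField.inclusion (hilbertClassField_le_rayClassField h𝔪) a)).card = genusClassNumber K := by
  set incl := IntermediateField.inclusion (hilbertClassField_le_rayClassField (K := K) h𝔪) with hincl
  have hlq : l ≠ q := by omega
  obtain ⟨rH, res, hres, hsurj, hact, hartin⟩ := exists_res_restrict (K := K) h𝔪
  have hn4 : (l * q) % 4 = 3 := by rw [Nat.mul_mod, hl4, hq4]
  -- Step 1: `Stab_G(a) = Stab_G(a, b)`, so the two orbits have the same size
  have hstab : stabilizer G (incl a) = stabilizer G ((incl a, incl b) : rayClassField K 𝔪 × rayClassField K 𝔪) := by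
    ext g
    rw [mem_stabilizer_iff, mem_stabilizer_iff, Prod.smul_mk, Prod.mk.injEq]
    exact ⟨fun h => ⟨h, hfib g g.2 h⟩, fun h => h.1⟩
  have h1 : ((univ : Finset G).image (fun g => g • incl a)).card =
      ((univ : Finset G).image (fun g => g • ((incl a, incl b) : rayClassField K 𝔪 × rayClassField K 𝔪))).card := by
    have e1 := card_image_smul_eq_card_quotient (G := G) (incl a)
    have e2 := card_image_smul_eq_card_quotient (G := G) ((incl a, incl b) : rayClassField K 𝔪 × rayClassField K 𝔪)
    exact e1.trans ((Nat.card_congr (QuotientGroup.quotientMulEquivOfEq hstab).toEquiv).trans e2.symm)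
  -- Step 2: the pair orbit is counted through `rH`, on which `Gal(H/K)` acts freely
  have h2 : ((univ : Finset G).image (fun g => g • ((incl a, incl b) : rayClassField K 𝔪 × rayClassField K 𝔪))).card =
      ((univ : Finset G).image (fun g : G => rH (g : rayClassField K 𝔪 ≃ₐ[K] rayClassField K 𝔪))).card := by
    have himg : (univ : Finset G).image (fun g : G => g • ((incl a, incl b) : rayClassField K 𝔪 × rayClassField K 𝔪)) =
        ((univ : Finset G).image (fun g : G => rH (g : rayClassField K 𝔪 ≃ₐ[K] rayClassField K 𝔪) • ((a, b) : hilbertClassField K × hilbertClassField K))).image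
          (fun p : hilbertClassField K × hilbertClassField K => ((incl p.1, incl p.2) : rayClassField K 𝔪 × rayClassField K 𝔪)) := by
      rw [Finset.image_image]
      refine Finset.image_congr fun g _ => ?_
      rw [Function.comp_apply, Subgroup.smul_def, Prod.smul_mk, Prod.smul_mk, AlgEquiv.smul_def, AlgEquiv.smul_def, hact, hact]
      rfl
    rw [himg, card_image_of_injective _ (fun p p' h => by
      simp only [Prod.mk.injEq] at h
      exact Prod.ext (incl.injective h.1) (incl.injective h.2))]
    exact card_image_smul_eq_card_image_of_free (fun g : G => rH (g : rayClassField K 𝔪 ≃ₐ[K] rayClassField K 𝔪))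
      ((a, b) : hilbertClassField K × hilbertClassField K) _ (fun g => rfl)
      (fun σ hσ => by
        rw [Prod.smul_mk, Prod.mk.injEq, AlgEquiv.smul_def, AlgEquiv.smul_def] at hσ
        exact hfree σ hσ.1 hσ.2)
  -- Step 3: `#{rH g} = #{res g} = #res(G)`
  have h3 : ((univ : Finset G).image (fun g : G => rH (g : rayClassField K 𝔪 ≃ₐ[K] rayClassField K 𝔪))).card =
      ((univ : Finset G).image (fun g : G => res (g : rayClassField K 𝔪 ≃ₐ[K] rayClassField K 𝔪))).card := by
    have : (univ : Finset G).image (fun g : G => res (g : rayClassField K 𝔪 ≃ₐ[K] rayClassField K 𝔪)) =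
        ((univ : Finset G).image (fun g : G => rH (g : rayClassField K 𝔪 ≃ₐ[K] rayClassField K 𝔪))).image (hilbertClassField.artinEquiv K).symm := by
      rw [Finset.image_image]; exact Finset.image_congr fun g _ => by rw [Function.comp_apply, hres]
    rw [this, card_image_of_injective _ (hilbertClassField.artinEquiv K).symm.injective]
  -- Step 4: `res(G) = res(Stab rl)` (`ζ₄ ∉ H`)
  have hc : ∃ c : rayClassField K 𝔪 ≃ₐ[K] rayClassField K 𝔪, res c = 1 ∧ c • ζ = -ζ ∧ c • incl rl = incl rl := by
    have hw0 : (Ideal.span {w} : Ideal (𝓞 K)) ≠ ⊥ := by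
      rw [Ne, Ideal.span_singleton_eq_bot]; rintro rfl
      have h := hw; rw [zero_pow two_ne_zero] at h
      have : ((l * q : ℕ) : 𝓞 K) = 0 := neg_eq_zero.mp h.symm
      exact (mul_ne_zero hl.ne_zero hq.ne_zero) (by exact_mod_cast this)
    refine ⟨artinSymbol (galFrob K (rayClassField K 𝔪)) (Ideal.span {w}), ?_, ?_, ?_⟩
    · rw [hartin _ hw0, ClassGroup.mk0_eq_one_iff]; exact ⟨w, rfl⟩
    · rw [AlgEquiv.smul_def]; exact artinSymbol_span_sqrt_apply_zeta_four hK hζ hn4 w hw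
    · have h1' : rH (artinSymbol (galFrob K (rayClassField K 𝔪)) (Ideal.span {w})) = 1 := by
        have h := hartin _ hw0
        have hprin : ClassGroup.mk0 ⟨Ideal.span {w}, mem_nonZeroDivisors_of_ne_zero hw0⟩ = 1 := (ClassGroup.mk0_eq_one_iff _).mpr ⟨w, rfl⟩
        rw [hres, MulEquiv.symm_apply_eq, hprin, map_one] at h
        exact h
      rw [AlgEquiv.smul_def, hact, h1', AlgEquiv.one_apply]
  have hi : ∀ x : rayClassField K 𝔪 ≃ₐ[K] rayClassField K 𝔪, x • ζ = ζ ∨ x • ζ = -ζ := by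
    intro x
    apply smul_eq_self_or_neg_of_smul_sq_eq
    have h2' : ζ * ζ = -1 := by
      have h4 : ζ ^ 4 = 1 := hζ.pow_eq_one
      have hne : ζ ^ 2 ≠ 1 := hζ.pow_ne_one_of_pos_of_lt (by norm_num) (by norm_num)
      have hfac : (ζ ^ 2 - 1) * (ζ ^ 2 + 1) = 0 := by
        have : ζ ^ 4 - 1 = 0 := by rw [h4, sub_self]
        linear_combination this
      rw [← pow_two]
      rcases mul_eq_zero.mp hfac with h | h
      · exact absurd (sub_eq_zero.mp h) hne
      · exact eq_neg_of_add_eq_zero_left h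
    rw [h2', smul_neg, smul_one]
  have h4 : G.map res = (stabilizer (rayClassField K 𝔪 ≃ₐ[K] rayClassField K 𝔪) (incl rl)).map res :=
    map_eq_map_of_exists_ker_neg res (fun g hg => mem_stabilizer_iff.mpr (hG1 g hg)) (fun x hx hxi => hG3 x hx hxi) hi hc
  -- Step 5: `res(Stab rl) = Cl²`, of order `g(K)`
  have h2tors : Nat.card {c : ClassGroup (𝓞 K) // c ^ 2 = 1} = 2 := card_sq_eq_one_eq_two hK hl hq hlq hd
  have hkerw : ∀ π : rayClassField K 𝔪 ≃ₐ[K] rayClassField K 𝔪, res π = 1 → π • incl rl = incl rl := by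
    intro π hπ
    have h1' : rH π = 1 := by rw [hres, MulEquiv.symm_apply_eq] at hπ; rw [hπ, map_one]
    rw [AlgEquiv.smul_def, hact, h1', AlgEquiv.one_apply]
  have hwsign : ∀ g' : rayClassField K 𝔪 ≃ₐ[K] rayClassField K 𝔪, g' • incl rl = incl rl ∨ g' • incl rl = -incl rl := by
    intro g'
    apply smul_eq_self_or_neg_of_smul_sq_eq
    rw [← pow_two, hrl, AlgEquiv.smul_def, map_natCast]
  have hmove : ∃ g₀ : rayClassField K 𝔪 ≃ₐ[K] rayClassField K 𝔪, g₀ • incl rl ≠ incl rl := by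
    by_contra hall
    have hall' : ∀ g' : rayClassField K 𝔪 ≃ₐ[K] rayClassField K 𝔪, g' • incl rl = incl rl := fun g' => not_not.mp (not_exists.mp hall g')
    have hmem : incl rl ∈ IntermediateField.fixedField (⊤ : Subgroup (rayClassField K 𝔪 ≃ₐ[K] rayClassField K 𝔪)) := fun g' => hall' g'
    rw [← IntermediateField.fixingSubgroup_bot, IsGalois.fixedField_fixingSubgroup, IntermediateField.mem_bot] at hmem
    obtain ⟨k, hk⟩ := hmem
    apply not_isSquare_natCast_of_prime hK hl hl4
    refine ⟨k, ?_⟩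
    apply (algebraMap K (rayClassField K 𝔪)).injective
    rw [map_natCast, map_mul, hk, ← pow_two, hrl]
  have h5 : (stabilizer (rayClassField K 𝔪 ≃ₐ[K] rayClassField K 𝔪) (incl rl)).map res = (powMonoidHom (α := ClassGroup (𝓞 K)) 2).range :=
    map_stabilizer_eq_range_sq res hsurj hwsign hkerw hmove h2tors
  have h6 := card_image_coe_eq_natCard_map res G
  rw [h4, h5, card_range_sq_eq_genusClassNumber] at h6
  convert h1.trans (h2.trans (h3.trans h6)) using 3

end Summit.BirchSwinnertonDyer.PrintCf2.TheoremAHeegnerOrbit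

end
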